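import Literature.Geometry.Kaehler.ComplexTorusEquivariantEndomorphismAlgebraCommutantCyclicPowersCharpoly
import HarnessLib

/-!
# The isotypic decomposition of a power is the coarsening of that of `u` along `d ↦ d/(d,k)`:
# `e_m(u^k) = Σ_{d ∣ n, d/(d,k) = m} e_d(u)`, `φ(m) h_m(u^k) = Σ_{d/(d,k) = m} φ(d) h_d(u)`, and the idempotents,
# eigenvalue orders and multiplicities do not depend on the exponent `n`

Layer `Literature/Geometry/Kaehler`, namespace `Literature.Geometry.Kaehler.ComplexTorus` (§1 in
`Literature.Geometry.Kaehler.CyclotomicIdempotents`); lane `lit-hodgefound` (Track 2 foundations library), Layer A2,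
row «A2-26(fd)» (self-proposed 2026-08-28, prover seat `lit-hodgefound-p10`, generation 28, FILE 5).  Generation 7
built the isotypic decomposition `X ∼ Π_{d ∣ n} X^{e_d(u)}` of a complex torus under `u ∈ End_ℚ(X)` with `uⁿ = 1` from
the Chinese-remainder idempotents `E_{n,d} ∈ ℚ[x]/(xⁿ − 1)` (`e_d(u) = E_{n,d}(u)`); FILES 2–4 of this generation
followed the powers `u^k` through `Φ_d(x) ∣ Φ_{d/(d,k)}(x^k)`.  THIS FILE computes the idempotents of the power
themselves: modulo `xⁿ − 1`, **`E_{n,m}(x^k) ≡ Σ_{d ∣ n, d/(d,k) = m} E_{n,d}(x)`** (both sides are `≡ 1 mod Φ_d` when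
`d/(d,k) = m` and `≡ 0 mod Φ_d` otherwise), hence `e_m(u^k) = Σ_{d/(d,k) = m} e_d(u)`: the isotypic component
`X^{e_m(u^k)}` of the power is the sum of the components `X^{e_d(u)}` with `d/(d,k) = m` — the decomposition of `u`
REFINES that of `u^k` (Lange–Rodríguez: `σ^k` acts on `A^{e_d}` through `W_d|⟨σ^k⟩ ≅ W_{d/(d,k)}^{φ(d)/φ(d/(d,k))}`) —
and, by additivity of the trace `rk Λ(X^e) = Tr e`, **`φ(m) h_m(u^k) = Σ_{d ∣ n, d/(d,k) = m} φ(d) h_d(u)`**, the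
multiplicity formula matching FILE 4's `P^r_{u^k} = Π_d Φ_{d/(d,k)}^{(φ(d)/φ(d/(d,k))) h_d}`.  A by-product of the same
uniqueness argument: `E_{nt,d} ≡ E_{n,d} (mod xⁿ − 1)`, so `e_d(u)`, `D = eigenvalueOrders n u` and `h_d` DO NOT
DEPEND on the exponent `n` with `uⁿ = 1` used to define them.  CONSUMED BY NAME, nothing restated: generation 7's
`cycIdem` / `cyclicIdempotent` / `cyclotomic_dvd_cycIdem` / `cyclotomic_dvd_cycIdem_sub_one` / `X_pow_sub_one_dvd_of_forall` /
`X_pow_sub_one_dvd_sub_cycIdem` / `aeval_eq_of_dvd_sub` / `aeval_eq_zero_of_dvd` / `sum_cyclicIdempotent` /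
`cyclicIdempotent_of_not_mem_divisors` / `isIdempotentElem_cyclicIdempotent` / `subRank_idemSubspace_eq_trace_rat` /
`subRank_cyclicIdempotent_eq_totient_mul` / `cyclicMultiplicity`, generation 9's `eigenvalueOrders` / `mem_eigenvalueOrders`,
FILE 2's `cyclotomic_dvd_expand_cyclotomic_div_gcd` / `eigenvalueOrders_pow`, FILE 1's `swapI` lemmas, FILE 3's
`cyclicMultiplicity_gaussSq_four`.  Theorems only; NO definition, NO named fact (D-0026, net debt 0).

## The print

* H. Lange, R. E. Rodríguez, *Decomposition of Jacobians by Prym Varieties*, LNM 2310 (2022), §2.8 (2.22)–(2.23)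
  (p0040: «`1 = e_{W_1} + ⋯ + e_{W_r}` […] the idempotents `e_{W_j}` are orthogonal to each other», «the unique central
  idempotent»), §2.9 Thm. 2.9.1 (p0043: the isotypical decomposition `μ : A^{e_1} × ⋯ × A^{e_r} → A`, «`G` acts on
  `A^{e_i}` by a multiple of the representation `W_i`»), Prop. 2.9.3 (p0046: «`ρ_r = Σ_j h_j W_j`»), §6.1.1 Prop. 6.1.2
  (p0153: the `W_d`, `d ∣ n`, of a cyclic group; «`W_d := ⊕_{γ ∈ Gal(K_d/ℚ)} V_d^γ`»).  Restricted to the subgroup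
  `⟨σ^k⟩ ≅ ℤ/(n/(n,k))`, the character `V_d = χ_{n/d}` of order `d` becomes a character of order `d/(d,k)`, so
  `W_d|⟨σ^k⟩ = (φ(d)/φ(d/(d,k))) W_{d/(d,k)}` and `e_{W_m}(σ^k) = Σ_{d/(d,k) = m} e_{W_d}(σ)`.
* A. Carocca, H. Lange, R. E. Rodríguez, *Abelian varieties with finite abelian group action*, Arch. Math. 112
  (2019), §2.2 (p0004: «the orders of the eigenvalues of `α`»), §3 (the group algebra decomposition under a subgroup).
* H. Lange, *Abelian Varieties over the Complex Numbers* (2023), §2.4.4 Cor. 2.4.28 («`dim X^ε = Tr_a(ε)`») — the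
  tree's `subRank_idemSubspace_eq_trace_rat`.

## What is proved (`A` any `ℚ`-algebra, `u ∈ A`, `uⁿ = 1`, `n, k > 0`; `E_{n,d} = cycIdem n d`, `e_d(v) = cyclicIdempotent n v d`;
torus: `u ∈ End_ℚ(X)`, `h_d(v) = cyclicMultiplicity Φ n v d`, `D(v) = eigenvalueOrders n v`; `m_d := d/(d,k)`)

* §1 POLYNOMIALS: `cyclotomic_dvd_expand_cycIdem_sub_one` (`Φ_d ∣ E_{n,m}(x^k) − 1` for `m = m_d`),
  `cyclotomic_dvd_expand_cycIdem` (`Φ_d ∣ E_{n,m}(x^k)` for `m ≠ m_d`),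
  **`X_pow_sub_one_dvd_expand_cycIdem_mul_cycIdem_sub`** (`xⁿ − 1 ∣ E_{n,m}(x^k) E_{n,d} − [m_d = m] E_{n,d}`),
  `X_pow_sub_one_dvd_cycIdem_mul_sub` (`xⁿ − 1 ∣ E_{nt,d} − E_{n,d}`).
* §2 ALGEBRA: **`cyclicIdempotent_pow_mul_cyclicIdempotent`** (`e_m(u^k) e_d(u) = [m_d = m] e_d(u)`),
  **`cyclicIdempotent_pow_eq_sum`** (`e_m(u^k) = Σ_{d ∣ n, m_d = m} e_d(u)`; for `(k, n) = 1` this is generation 8's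
  `cyclicIdempotent_pow_of_coprime`), **`cyclicIdempotent_mul_eq`** (`e_d` computed with the exponent `nt` equals `e_d`
  computed with `n`).
* §3 TORUS: `idemSubspace_cyclicIdempotent_le_pow` (`X^{e_d(u)} ⊆ X^{e_{m_d}(u^k)}`),
  **`totient_mul_cyclicMultiplicity_pow_eq_sum`** (`φ(m) h_m(u^k) = Σ_{d ∣ n, m_d = m} φ(d) h_d(u)`),
  **`cyclicMultiplicity_pow_eq_sum`** (`h_m(u^k) = Σ_{m_d = m} (φ(d)/φ(m)) h_d(u)`), `le_cyclicMultiplicity_pow`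
  (`(φ(d)/φ(m_d)) h_d(u) ≤ h_{m_d}(u^k)`), `cyclicIdempotent_pow_eq_sum_eigenvalueOrders` /
  `totient_mul_cyclicMultiplicity_pow_eq_sum_eigenvalueOrders` (only `d ∈ D(u)` contribute),
  **`squarefree_charpoly_coe_pow_iff`** (`P^r_{u^k}` squarefree iff `Σ_{m_d = m} (φ(d)/φ(m)) h_d(u) ≤ 1` for all `m ∣ n`),
  `squarefree_charpoly_coe_of_pow` (`P^r_{u^k}` squarefree ⟹ `P^r_u` squarefree), `cyclicMultiplicity_pow_of_coprime`,
  **`cyclicMultiplicity_mul_eq`** / **`eigenvalueOrders_mul_eq`** (`h` and `D` do not depend on the exponent).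
* §4 INSTANCE: `swapI` on `E_i × E_i` (`D = {8}`, `h_8 = 1`): `swapEnd_sq` (`u² = (i, i)`), **`cyclicIdempotent_swapI_sq_four`**
  (`e_4(u²) = e_8(u)`), `cyclicMultiplicity_swapI_eight` (`h_8(u) = 1`), **`cyclicMultiplicity_swapI_sq_four`**
  (`h_4(u²) = φ(8)/φ(4) = 2` with the exponent `8`), `cyclicMultiplicity_swapI_sq_four'` (the same with the exponent `4`),
  `cyclicMultiplicity_swapI_sq_eq_gaussSq` (agreement with FILE 3's `h_4(i, i) = 2`).

## References

* [LangeRodriguez2022] H. Lange, R. E. Rodríguez, *Decomposition of Jacobians by Prym Varieties*, LNM 2310 (2022),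
  §2.8 (2.22)–(2.23), §2.9 Thm. 2.9.1, Prop. 2.9.3, §6.1.1 Prop. 6.1.2.
* [CaroccaLangeRodriguez2019] A. Carocca, H. Lange, R. E. Rodríguez, Arch. Math. 112 (2019), §2.2, §3.
* [Lange2023AbelianVarietiesComplex] H. Lange, *Abelian Varieties over the Complex Numbers* (2023), §2.4.4 Cor. 2.4.28.
* [DolgachevZarhin2024] I. Dolgachev, Yu. G. Zarhin, *Endomorphisms of Complex Abelian Varieties* (2024), §2.2 Thm. 2.18.
* [HornJohnson2013] R. A. Horn, C. R. Johnson, *Matrix Analysis*, 2nd ed. (2013), §1.4 Def. 1.4.4.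
-/

noncomputable section

open Module Function Polynomial Finset
open scoped Matrix

namespace Literature.Geometry.Kaehler

/-! ### §1 The Chinese-remainder idempotents under `x ↦ x^k`, modulo `xⁿ − 1` -/

namespace CyclotomicIdempotents

section Polynomials

variable {n : ℕ}

/-- `d/(d,k) ∣ n` for `d ∣ n`. [folklore] -/
private theorem div_gcd_mem_divisors {d : ℕ} (hd : d ∈ n.divisors) (k : ℕ) : d / d.gcd k ∈ n.divisors :=
  Nat.mem_divisors.2 ⟨(Nat.div_dvd_of_dvd (Nat.gcd_dvd_left d k)).trans (Nat.dvd_of_mem_divisors hd),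
    (Nat.mem_divisors.1 hd).2⟩

/-- **`Φ_d ∣ E_{n,m}(x^k) − 1` for `m = d/(d,k)`** (`E_{n,m} ≡ 1 mod Φ_m` and `Φ_d ∣ Φ_m(x^k)`).
[cite: LangeRodriguez2022, §2.8 (2.22)–(2.23) («the unique central idempotent»), p0040; §6.1.1 Prop. 6.1.2, p0153] -/
theorem cyclotomic_dvd_expand_cycIdem_sub_one {d : ℕ} (hd : 0 < d) {k : ℕ} (hk : 0 < k) {m : ℕ} (hm : d / d.gcd k = m) :
    cyclotomic d ℚ ∣ expand ℚ k (cycIdem n m) - 1 := by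
  subst hm
  obtain ⟨a, ha⟩ := cyclotomic_dvd_cycIdem_sub_one n (d / d.gcd k)
  have h : expand ℚ k (cycIdem n (d / d.gcd k)) - 1 = expand ℚ k (cyclotomic (d / d.gcd k) ℚ) * expand ℚ k a := by
    rw [← map_mul, ← ha, map_sub, map_one]
  have h1 : cyclotomic d ℚ ∣ expand ℚ k (cyclotomic (d / d.gcd k) ℚ) := cyclotomic_dvd_expand_cyclotomic_div_gcd hd hk
  rw [h]
  exact dvd_mul_of_dvd_left h1 _

/-- **`Φ_d ∣ E_{n,m}(x^k)` for `m ≠ d/(d,k)`**, `d ∣ n` (`E_{n,m} ≡ 0 mod Φ_{d/(d,k)}` and `Φ_d ∣ Φ_{d/(d,k)}(x^k)`).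
[cite: LangeRodriguez2022, §2.8 (2.22)–(2.23), p0040; §6.1.1 Prop. 6.1.2, p0153] -/
theorem cyclotomic_dvd_expand_cycIdem {d : ℕ} (hd : d ∈ n.divisors) {k : ℕ} (hk : 0 < k) {m : ℕ} (hm : d / d.gcd k ≠ m) :
    cyclotomic d ℚ ∣ expand ℚ k (cycIdem n m) := by
  have h1 : cyclotomic d ℚ ∣ expand ℚ k (cyclotomic (d / d.gcd k) ℚ) :=
    cyclotomic_dvd_expand_cyclotomic_div_gcd (Nat.pos_of_mem_divisors hd) hk
  have h2 : cyclotomic (d / d.gcd k) ℚ ∣ cycIdem n m := cyclotomic_dvd_cycIdem (div_gcd_mem_divisors hd k) hm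
  obtain ⟨a, ha⟩ := h2
  have h3 : expand ℚ k (cycIdem n m) = expand ℚ k (cyclotomic (d / d.gcd k) ℚ) * expand ℚ k a := by
    rw [← map_mul, ← ha]
  rw [h3]
  exact dvd_mul_of_dvd_left h1 _

open scoped Classical in
/-- **`xⁿ − 1 ∣ E_{n,m}(x^k) · E_{n,d} − [d/(d,k) = m] E_{n,d}`** (`d ∣ n`): modulo every `Φ_{d'}`, `d' ∣ n`, both sides
agree. [cite: LangeRodriguez2022, §2.8 (2.22)–(2.23), p0040] -/
theorem X_pow_sub_one_dvd_expand_cycIdem_mul_cycIdem_sub (hn : 0 < n) {d : ℕ} (hd : d ∈ n.divisors) {k : ℕ}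
    (hk : 0 < k) (m : ℕ) :
    X ^ n - 1 ∣ expand ℚ k (cycIdem n m) * cycIdem n d - if d / d.gcd k = m then cycIdem n d else 0 := by
  refine X_pow_sub_one_dvd_of_forall hn fun d' hd' ↦ ?_
  by_cases hdd : d' = d
  · subst hdd
    split_ifs with h
    · rw [show expand ℚ k (cycIdem n m) * cycIdem n d' - cycIdem n d' = (expand ℚ k (cycIdem n m) - 1) * cycIdem n d' by ring]
      exact dvd_mul_of_dvd_left (cyclotomic_dvd_expand_cycIdem_sub_one (Nat.pos_of_mem_divisors hd') hk h) _
    · rw [sub_zero]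
      exact dvd_mul_of_dvd_left (cyclotomic_dvd_expand_cycIdem hd' hk h) _
  · have hE : cyclotomic d' ℚ ∣ cycIdem n d := cyclotomic_dvd_cycIdem hd' hdd
    split_ifs
    · exact dvd_sub (dvd_mul_of_dvd_right hE _) hE
    · rw [sub_zero]
      exact dvd_mul_of_dvd_right hE _

/-- **`xⁿ − 1 ∣ E_{nt,d} − E_{n,d}`** (`n, t > 0`): the Chinese-remainder idempotents for the exponent `nt` reduce to
those for `n` modulo `xⁿ − 1` (both `≡ 1 mod Φ_d` and `≡ 0 mod Φ_m`, `m ∣ n`, `m ≠ d`; for `d ∤ n` both `≡ 0`).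
[cite: LangeRodriguez2022, §2.8 («the unique central idempotent»), p0040] -/
theorem X_pow_sub_one_dvd_cycIdem_mul_sub (hn : 0 < n) {t : ℕ} (ht : 0 < t) (d : ℕ) :
    X ^ n - 1 ∣ cycIdem (n * t) d - cycIdem n d := by
  by_cases hd : d ∈ n.divisors
  · exact X_pow_sub_one_dvd_sub_cycIdem hn (cyclotomic_dvd_cycIdem_sub_one (n * t) d) fun m hm hmd ↦
      cyclotomic_dvd_cycIdem (Nat.mem_divisors.2 ⟨(Nat.dvd_of_mem_divisors hm).trans (dvd_mul_right n t),
        Nat.mul_ne_zero hn.ne' ht.ne'⟩) hmd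
  · refine dvd_sub (X_pow_sub_one_dvd_of_forall hn fun m hm ↦ cyclotomic_dvd_cycIdem
      (Nat.mem_divisors.2 ⟨(Nat.dvd_of_mem_divisors hm).trans (dvd_mul_right n t), Nat.mul_ne_zero hn.ne' ht.ne'⟩)
      fun h ↦ hd (h ▸ hm)) (X_pow_sub_one_dvd_of_forall hn fun m hm ↦ cyclotomic_dvd_cycIdem hm fun h ↦ hd (h ▸ hm))

end Polynomials

/-! ### §2 `e_m(u^k) = Σ_{d/(d,k) = m} e_d(u)` in any `ℚ`-algebra -/

section Algebra

variable {A : Type*} [Ring A] [Algebra ℚ A] {n : ℕ} {u : A}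

open scoped Classical in
/-- **`e_m(u^k) · e_d(u) = [d/(d,k) = m] e_d(u)`** (`d ∣ n`): the `d`-th isotypic projector of `u` lies under the
`d/(d,k)`-th isotypic projector of `u^k` and is killed by the others. [cite: LangeRodriguez2022, §2.9 Thm. 2.9.1 (a) («`G`-stable», «`Hom_G(A^{e_i}, A^{e_j}) = 0`»), p0043; §6.1.1 Prop. 6.1.2, p0153] -/
theorem cyclicIdempotent_pow_mul_cyclicIdempotent (hn : 0 < n) (hu : u ^ n = 1) {d : ℕ} (hd : d ∈ n.divisors)
    {k : ℕ} (hk : 0 < k) (m : ℕ) :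
    cyclicIdempotent n (u ^ k) m * cyclicIdempotent n u d = if d / d.gcd k = m then cyclicIdempotent n u d else 0 := by
  have h := aeval_eq_of_dvd_sub hu (X_pow_sub_one_dvd_expand_cycIdem_mul_cycIdem_sub hn hd hk m)
  rw [map_mul, expand_aeval] at h
  rw [cyclicIdempotent, cyclicIdempotent, h]
  split_ifs
  · rfl
  · exact map_zero _

open scoped Classical in
/-- **`e_m(u^k) = Σ_{d ∣ n, d/(d,k) = m} e_d(u)`** — the isotypic decomposition of `u^k` is the coarsening of that of
`u` along `d ↦ d/(d,k)` (an eigenvalue of order `d` of `u` is an eigenvalue of order `d/(d,k)` of `u^k`).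
[cite: LangeRodriguez2022, §2.8 (2.22) («`1 = e_{W_1} + ⋯ + e_{W_r}`»), p0040; §6.1.1 Prop. 6.1.2, p0153]
[cite: CaroccaLangeRodriguez2019, §2.2 («the orders of the eigenvalues of `α`»), p0004] -/
theorem cyclicIdempotent_pow_eq_sum (hn : 0 < n) (hu : u ^ n = 1) {k : ℕ} (hk : 0 < k) (m : ℕ) :
    cyclicIdempotent n (u ^ k) m = ∑ d ∈ n.divisors.filter (fun d ↦ d / d.gcd k = m), cyclicIdempotent n u d := by
  rw [Finset.sum_filter, ← mul_one (cyclicIdempotent n (u ^ k) m), ← sum_cyclicIdempotent hn hu, Finset.mul_sum]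
  exact Finset.sum_congr rfl fun d hd ↦ cyclicIdempotent_pow_mul_cyclicIdempotent hn hu hd hk m

/-- **The idempotents do not depend on the exponent: `e_d` computed with `nt` (for `u^{nt} = 1`) equals `e_d` computed
with `n` (`uⁿ = 1`).** [cite: LangeRodriguez2022, §2.8 («the unique central idempotent»), p0040] -/
theorem cyclicIdempotent_mul_eq (hn : 0 < n) (hu : u ^ n = 1) {t : ℕ} (ht : 0 < t) (d : ℕ) :
    cyclicIdempotent (n * t) u d = cyclicIdempotent n u d := by
  rw [cyclicIdempotent, cyclicIdempotent]
  exact aeval_eq_of_dvd_sub hu (X_pow_sub_one_dvd_cycIdem_mul_sub hn ht d)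

end Algebra

end CyclotomicIdempotents

/-! ### §3 Torus level: `X^{e_d(u)} ⊆ X^{e_{d/(d,k)}(u^k)}` and `φ(m) h_m(u^k) = Σ_{d/(d,k) = m} φ(d) h_d(u)` -/

namespace ComplexTorus

open CyclotomicIdempotents

universe u

variable {ι : Type u} [Fintype ι] [DecidableEq ι] {E : Type*} [NormedAddCommGroup E] [NormedSpace ℂ E]
  {Φ : (ι → ℝ) ≃L[ℝ] E} {n : ℕ} {u : endAlgRat Φ}

section Torus

/-- `(u^k)ⁿ = 1`. [folklore] -/
private theorem pow_pow_eq_one' (hu : u ^ n = 1) (k : ℕ) : (u ^ k) ^ n = 1 := by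
  rw [← pow_mul, mul_comm, pow_mul, hu, one_pow]

omit [DecidableEq ι] in
/-- Real base change of a product of rational matrices. [folklore] -/
private theorem map_ratCast_mul (A B : Matrix ι ι ℚ) :
    (A * B).map (Rat.cast : ℚ → ℝ) = A.map (Rat.cast : ℚ → ℝ) * B.map (Rat.cast : ℚ → ℝ) := by
  rw [← Rat.coe_castHom, Matrix.map_mul]

/-- **`X^{e_d(u)} ⊆ X^{e_{d/(d,k)}(u^k)}`** — every isotypic component of `u` lies in one isotypic component of `u^k`.
[cite: LangeRodriguez2022, §2.9 Thm. 2.9.1 (a)–(b), p0043; §6.1.1 Prop. 6.1.2, p0153] -/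
theorem idemSubspace_cyclicIdempotent_le_pow (hn : 0 < n) (hu : u ^ n = 1) {d : ℕ} (hd : d ∈ n.divisors) {k : ℕ}
    (hk : 0 < k) :
    idemSubspace ((cyclicIdempotent n u d : endAlgRat Φ) : Matrix ι ι ℚ) ≤
      idemSubspace ((cyclicIdempotent n (u ^ k) (d / d.gcd k) : endAlgRat Φ) : Matrix ι ι ℚ) := by
  intro x hx
  obtain ⟨z, rfl⟩ := mem_idemSubspace_iff.1 hx
  have hmul : (cyclicIdempotent n (u ^ k) (d / d.gcd k) : endAlgRat Φ) * cyclicIdempotent n u d = cyclicIdempotent n u d := by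
    rw [cyclicIdempotent_pow_mul_cyclicIdempotent hn hu hd hk, if_pos rfl]
  have hcoe := congrArg (fun y : endAlgRat Φ ↦ ((y : Matrix ι ι ℚ).map (Rat.cast : ℚ → ℝ))) hmul
  simp only [Subalgebra.coe_mul, map_ratCast_mul] at hcoe
  refine mem_idemSubspace_iff.2 ⟨((cyclicIdempotent n u d : endAlgRat Φ) : Matrix ι ι ℚ).map (Rat.cast : ℚ → ℝ) *ᵥ z, ?_⟩
  rw [Matrix.mulVec_mulVec, hcoe]

open scoped Classical in
/-- **`φ(m) h_m(u^k) = Σ_{d ∣ n, d/(d,k) = m} φ(d) h_d(u)`** (`m ∣ n`): `rk Λ(X^{e_m(u^k)}) = Tr e_m(u^k) = Σ Tr e_d(u)`.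
[cite: LangeRodriguez2022, §2.9 Prop. 2.9.3 (i), p0046; §6.1.1 Prop. 6.1.2, p0153] [cite: Lange2023AbelianVarietiesComplex, §2.4.4 Cor. 2.4.28 («`dim X^ε = Tr(ε)`»)] -/
theorem totient_mul_cyclicMultiplicity_pow_eq_sum (hn : 0 < n) (hu : u ^ n = 1) {k : ℕ} (hk : 0 < k) {m : ℕ}
    (hm : m ∈ n.divisors) :
    Nat.totient m * cyclicMultiplicity Φ n (u ^ k) m =
      ∑ d ∈ n.divisors.filter (fun d ↦ d / d.gcd k = m), Nat.totient d * cyclicMultiplicity Φ n u d := by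
  have h : (subRank (idemSubspace ((cyclicIdempotent n (u ^ k) m : endAlgRat Φ) : Matrix ι ι ℚ)) : ℚ) =
      ∑ d ∈ n.divisors.filter (fun d ↦ d / d.gcd k = m),
        (subRank (idemSubspace ((cyclicIdempotent n u d : endAlgRat Φ) : Matrix ι ι ℚ)) : ℚ) := by
    rw [subRank_idemSubspace_eq_trace_rat Φ (isIdempotentElem_cyclicIdempotent hn (pow_pow_eq_one' hu k) m),
      cyclicIdempotent_pow_eq_sum hn hu hk m, AddSubmonoidClass.coe_finsetSum, Matrix.trace_sum]
    exact Finset.sum_congr rfl fun d _ ↦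
      (subRank_idemSubspace_eq_trace_rat Φ (isIdempotentElem_cyclicIdempotent hn hu d)).symm
  rw [← subRank_cyclicIdempotent_eq_totient_mul Φ hn (pow_pow_eq_one' hu k) hm]
  have h' : subRank (idemSubspace ((cyclicIdempotent n (u ^ k) m : endAlgRat Φ) : Matrix ι ι ℚ)) =
      ∑ d ∈ n.divisors.filter (fun d ↦ d / d.gcd k = m),
        subRank (idemSubspace ((cyclicIdempotent n u d : endAlgRat Φ) : Matrix ι ι ℚ)) := by
    exact_mod_cast h
  rw [h']
  exact Finset.sum_congr rfl fun d hd ↦ subRank_cyclicIdempotent_eq_totient_mul Φ hn hu (Finset.mem_filter.1 hd).1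

open scoped Classical in
/-- **`h_m(u^k) = Σ_{d ∣ n, d/(d,k) = m} (φ(d)/φ(m)) h_d(u)`** — the multiplicities of the power (FILE 4's exponents
`e_d = (φ(d)/φ(d/(d,k))) h_d` summed over the fibre of `d ↦ d/(d,k)`). [cite: LangeRodriguez2022, §2.9 Prop. 2.9.3 («`ρ_r = Σ_j h_j W_j`»), p0046; §6.1.1 Prop. 6.1.2, p0153] -/
theorem cyclicMultiplicity_pow_eq_sum (hn : 0 < n) (hu : u ^ n = 1) {k : ℕ} (hk : 0 < k) {m : ℕ} (hm : m ∈ n.divisors) :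
    cyclicMultiplicity Φ n (u ^ k) m =
      ∑ d ∈ n.divisors.filter (fun d ↦ d / d.gcd k = m), Nat.totient d / Nat.totient m * cyclicMultiplicity Φ n u d := by
  have hφ : 0 < Nat.totient m := Nat.totient_pos.2 (Nat.pos_of_mem_divisors hm)
  apply Nat.eq_of_mul_eq_mul_left hφ
  rw [totient_mul_cyclicMultiplicity_pow_eq_sum hn hu hk hm, Finset.mul_sum]
  refine Finset.sum_congr rfl fun d hd ↦ ?_
  have hdm : Nat.totient m ∣ Nat.totient d := by
    rw [← (Finset.mem_filter.1 hd).2]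
    exact Nat.totient_dvd_of_dvd (Nat.div_dvd_of_dvd (Nat.gcd_dvd_left d k))
  rw [← mul_assoc, Nat.mul_div_cancel' hdm]

/-- **`(φ(d)/φ(d/(d,k))) h_d(u) ≤ h_{d/(d,k)}(u^k)`**: the component `X^{e_d(u)}` contributes `W_{d/(d,k)}^{(φ(d)/φ(d/(d,k))) h_d}`
to the power. [cite: LangeRodriguez2022, §2.9 Prop. 2.9.3, p0046] -/
theorem le_cyclicMultiplicity_pow (hn : 0 < n) (hu : u ^ n = 1) {d : ℕ} (hd : d ∈ n.divisors) {k : ℕ} (hk : 0 < k) :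
    Nat.totient d / Nat.totient (d / d.gcd k) * cyclicMultiplicity Φ n u d ≤ cyclicMultiplicity Φ n (u ^ k) (d / d.gcd k) := by
  classical
  rw [cyclicMultiplicity_pow_eq_sum hn hu hk
    (Nat.mem_divisors.2 ⟨(Nat.div_dvd_of_dvd (Nat.gcd_dvd_left d k)).trans (Nat.dvd_of_mem_divisors hd),
      (Nat.mem_divisors.1 hd).2⟩)]
  exact Finset.single_le_sum (f := fun d' ↦ Nat.totient d' / Nat.totient (d / d.gcd k) * cyclicMultiplicity Φ n u d')
    (fun _ _ ↦ Nat.zero_le _) (Finset.mem_filter.2 ⟨hd, rfl⟩)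

open scoped Classical in
/-- **`e_m(u^k) = Σ_{d ∈ D(u), d/(d,k) = m} e_d(u)`** — only the eigenvalue orders `D(u)` contribute (the other
`e_d(u)` vanish). [cite: CaroccaLangeRodriguez2019, §2.2 («all subvarieties `B_{d_i}` are of positive dimension»), p0004]
[cite: LangeRodriguez2022, §6.1.1 Prop. 6.1.2, p0153] -/
theorem cyclicIdempotent_pow_eq_sum_eigenvalueOrders (hn : 0 < n) (hu : u ^ n = 1) {k : ℕ} (hk : 0 < k) (m : ℕ) :
    cyclicIdempotent n (u ^ k) m =
      ∑ d ∈ (eigenvalueOrders n u).filter (fun d ↦ d / d.gcd k = m), cyclicIdempotent n u d := by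
  rw [cyclicIdempotent_pow_eq_sum hn hu hk m]
  refine (Finset.sum_subset (Finset.filter_subset_filter _ fun d hd ↦ (mem_eigenvalueOrders.1 hd).1) ?_).symm
  intro d hd hnd
  by_contra hne
  exact hnd (Finset.mem_filter.2 ⟨mem_eigenvalueOrders.2 ⟨(Finset.mem_filter.1 hd).1, hne⟩, (Finset.mem_filter.1 hd).2⟩)

open scoped Classical in
/-- **`φ(m) h_m(u^k) = Σ_{d ∈ D(u), d/(d,k) = m} φ(d) h_d(u)`** (`m ∣ n`; `h_d(u) = 0` off `D(u)`).
[cite: LangeRodriguez2022, §2.9 Prop. 2.9.3 (i), p0046; §6.1.1 Prop. 6.1.2, p0153] -/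
theorem totient_mul_cyclicMultiplicity_pow_eq_sum_eigenvalueOrders (hn : 0 < n) (hu : u ^ n = 1) {k : ℕ}
    (hk : 0 < k) {m : ℕ} (hm : m ∈ n.divisors) :
    Nat.totient m * cyclicMultiplicity Φ n (u ^ k) m =
      ∑ d ∈ (eigenvalueOrders n u).filter (fun d ↦ d / d.gcd k = m), Nat.totient d * cyclicMultiplicity Φ n u d := by
  rw [totient_mul_cyclicMultiplicity_pow_eq_sum hn hu hk hm]
  refine (Finset.sum_subset (Finset.filter_subset_filter _ fun d hd ↦ (mem_eigenvalueOrders.1 hd).1) ?_).symm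
  intro d hd hnd
  have hD : d ∉ eigenvalueOrders n u := fun h ↦ hnd (Finset.mem_filter.2 ⟨h, (Finset.mem_filter.1 hd).2⟩)
  rw [(cyclicMultiplicity_eq_zero_iff_not_mem hn hu (Finset.mem_filter.1 hd).1).2 hD, mul_zero]

open scoped Classical in
/-- **`P^r_{u^k}` is squarefree iff `Σ_{d ∣ n, d/(d,k) = m} (φ(d)/φ(m)) h_d(u) ≤ 1` for every `m ∣ n`** — the
squarefree certificate of FILES 1–4 read on the multiplicities of `u` (`ρ_r(u^k) = Σ_m h_m(u^k) W_m`, squarefree iff all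
`h_m(u^k) ≤ 1`). [cite: LangeRodriguez2022, §2.9 Prop. 2.9.3 («`ρ_r = Σ_j h_j W_j`») and §6.1.1 Prop. 6.1.2, p0046, p0153]
[cite: DolgachevZarhin2024, §2.2 Thm. 2.18, p0036] -/
theorem squarefree_charpoly_coe_pow_iff (hn : 0 < n) (hu : u ^ n = 1) {k : ℕ} (hk : 0 < k) :
    Squarefree ((u : Matrix ι ι ℚ) ^ k).charpoly ↔
      ∀ m ∈ n.divisors, ∑ d ∈ n.divisors.filter (fun d ↦ d / d.gcd k = m),
        Nat.totient d / Nat.totient m * cyclicMultiplicity Φ n u d ≤ 1 := by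
  rw [← SubmonoidClass.coe_pow, squarefree_charpoly_coe_iff_forall_cyclicMultiplicity_le_one Φ hn (pow_pow_eq_one' hu k)]
  refine forall₂_congr fun m hm ↦ ?_
  rw [cyclicMultiplicity_pow_eq_sum hn hu hk hm]

/-- **If `P^r_{u^k}` is squarefree then so is `P^r_u`** (`h_d(u) ≤ (φ(d)/φ(d/(d,k))) h_d(u) ≤ h_{d/(d,k)}(u^k) ≤ 1`).
[cite: LangeRodriguez2022, §2.9 Prop. 2.9.3, p0046] [cite: HornJohnson2013, §1.4 Def. 1.4.4 (p0112)] -/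
theorem squarefree_charpoly_coe_of_pow (hn : 0 < n) (hu : u ^ n = 1) {k : ℕ} (hk : 0 < k)
    (h : Squarefree ((u : Matrix ι ι ℚ) ^ k).charpoly) : Squarefree (u : Matrix ι ι ℚ).charpoly := by
  rw [squarefree_charpoly_coe_iff_forall_cyclicMultiplicity_le_one Φ hn hu]
  intro d hd
  rw [← SubmonoidClass.coe_pow,
    squarefree_charpoly_coe_iff_forall_cyclicMultiplicity_le_one Φ hn (pow_pow_eq_one' hu k)] at h
  have h1 := le_cyclicMultiplicity_pow hn hu hd hk
  have h2 := h _ (div_gcd_mem_divisors hd k)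
  have h3 : 0 < Nat.totient d / Nat.totient (d / d.gcd k) :=
    Nat.div_pos (Nat.le_of_dvd (Nat.totient_pos.2 (Nat.pos_of_mem_divisors hd))
      (Nat.totient_dvd_of_dvd (Nat.div_dvd_of_dvd (Nat.gcd_dvd_left d k))))
      (Nat.totient_pos.2 (Nat.pos_of_mem_divisors (div_gcd_mem_divisors hd k)))
  calc cyclicMultiplicity Φ n u d
      ≤ Nat.totient d / Nat.totient (d / d.gcd k) * cyclicMultiplicity Φ n u d := Nat.le_mul_of_pos_left _ h3
    _ ≤ cyclicMultiplicity Φ n (u ^ k) (d / d.gcd k) := h1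
    _ ≤ 1 := h2

/-- **`(k, n) = 1`: `h_d(u^k) = h_d(u)`** (generation 8's Galois invariance `cyclicIdempotent_pow_of_coprime`).
[cite: LangeRodriguez2022, §6.1.1 («`W_d` is defined over `ℚ`»), p0153] -/
theorem cyclicMultiplicity_pow_of_coprime (hn : 0 < n) (hu : u ^ n = 1) {k : ℕ} (hkn : k.Coprime n) (d : ℕ) :
    cyclicMultiplicity Φ n (u ^ k) d = cyclicMultiplicity Φ n u d := by
  rw [cyclicMultiplicity, cyclicMultiplicity, cyclicIdempotent_pow_of_coprime hn hu hkn d]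

/-- **The multiplicities do not depend on the exponent: `h_d` computed with `nt` equals `h_d` computed with `n`.**
[cite: LangeRodriguez2022, §2.9 Prop. 2.9.3, p0046] -/
theorem cyclicMultiplicity_mul_eq (hn : 0 < n) (hu : u ^ n = 1) {t : ℕ} (ht : 0 < t) (d : ℕ) :
    cyclicMultiplicity Φ (n * t) u d = cyclicMultiplicity Φ n u d := by
  rw [cyclicMultiplicity, cyclicMultiplicity, cyclicIdempotent_mul_eq hn hu ht]

/-- **The eigenvalue orders do not depend on the exponent: `eigenvalueOrders (nt) u = eigenvalueOrders n u`.**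
[cite: CaroccaLangeRodriguez2019, §2.2 («the orders of the eigenvalues of `α`»), p0004] -/
theorem eigenvalueOrders_mul_eq (hn : 0 < n) (hu : u ^ n = 1) {t : ℕ} (ht : 0 < t) :
    eigenvalueOrders (n * t) u = eigenvalueOrders n u := by
  ext d
  rw [mem_eigenvalueOrders, mem_eigenvalueOrders, cyclicIdempotent_mul_eq hn hu ht]
  constructor
  · rintro ⟨-, hne⟩
    refine ⟨?_, hne⟩
    by_contra hd
    exact hne (cyclicIdempotent_of_not_mem_divisors hn hu hd)
  · rintro ⟨hd, hne⟩
    exact ⟨Nat.mem_divisors.2 ⟨(Nat.dvd_of_mem_divisors hd).trans (dvd_mul_right n t), Nat.mul_ne_zero hn.ne' ht.ne'⟩,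
      hne⟩

end Torus

/-! ### §4 Instance: `swapI` on `E_i × E_i` — `h_8(u) = 1`, `h_4(u²) = φ(8)/φ(4) = 2` -/

section Swap

variable (hI : Complex.I.im ≠ 0)

/-- `u² = (i, i)` in `End_ℚ(E_i × E_i)` (FILE 1's `swapI_map_sq`, as elements of `End_ℚ`). [cite: Lange2023AbelianVarietiesComplex, §2.4.5 Exercise (10), p0126] -/
theorem swapEnd_sq :
    (⟨swapI.map (Int.cast : ℤ → ℚ), swapI_mem_endAlgRat hI⟩ :
        endAlgRat (prodPeriod (ellipticPeriod hI) (ellipticPeriod hI))) ^ 2 =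
      ⟨Matrix.fromBlocks gaussJ 0 0 gaussJ, gaussSq_mem_endAlgRat hI⟩ := by
  apply Subtype.ext
  rw [SubmonoidClass.coe_pow]
  exact swapI_map_sq

/-- **`e_4(u²) = e_8(u)`** on `E_i × E_i`: the fibre of `d ↦ d/(d,2)` over `4` inside `D(u) ∪ {d ∣ 8} ` is `{8}`.
[cite: LangeRodriguez2022, §2.8 (2.22)–(2.23), p0040; §6.1.1 Prop. 6.1.2, p0153] -/
theorem cyclicIdempotent_swapI_sq_four :
    cyclicIdempotent 8 ((⟨swapI.map (Int.cast : ℤ → ℚ), swapI_mem_endAlgRat hI⟩ :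
        endAlgRat (prodPeriod (ellipticPeriod hI) (ellipticPeriod hI))) ^ 2) 4 =
      cyclicIdempotent 8 (⟨swapI.map (Int.cast : ℤ → ℚ), swapI_mem_endAlgRat hI⟩ :
        endAlgRat (prodPeriod (ellipticPeriod hI) (ellipticPeriod hI))) 8 := by
  classical
  rw [cyclicIdempotent_pow_eq_sum (by norm_num) (swapEnd_pow_eight hI) two_pos 4]
  have hfilter : (Nat.divisors 8).filter (fun d ↦ d / d.gcd 2 = 4) = {8} := by decide
  rw [hfilter, Finset.sum_singleton]

/-- **`h_8(u) = 1`** for the order-`8` automorphism `u` of `E_i × E_i` (`P^r_u = Φ_8` squarefree, `D = {8}`).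
[cite: LangeRodriguez2022, §2.9 Prop. 2.9.3, p0046] -/
theorem cyclicMultiplicity_swapI_eight :
    cyclicMultiplicity (prodPeriod (ellipticPeriod hI) (ellipticPeriod hI)) 8
      (⟨swapI.map (Int.cast : ℤ → ℚ), swapI_mem_endAlgRat hI⟩ :
        endAlgRat (prodPeriod (ellipticPeriod hI) (ellipticPeriod hI))) 8 = 1 :=
  cyclicMultiplicity_eq_one_of_mem_eigenvalueOrders _ (by norm_num) (swapEnd_pow_eight hI) squarefree_charpoly_swapI
    (by rw [eigenvalueOrders_swapI]; exact Finset.mem_singleton_self 8)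

/-- **`h_4(u²) = φ(8)/φ(4) · h_8(u) = 2`** (with the exponent `8`): the component `X^{e_8(u)} = E_i × E_i` becomes `W_4²`
under `u² = (i, i)`. [cite: LangeRodriguez2022, §2.9 Prop. 2.9.3 and §6.1.1 Prop. 6.1.2, p0046, p0153] -/
theorem cyclicMultiplicity_swapI_sq_four :
    cyclicMultiplicity (prodPeriod (ellipticPeriod hI) (ellipticPeriod hI)) 8
      ((⟨swapI.map (Int.cast : ℤ → ℚ), swapI_mem_endAlgRat hI⟩ :
        endAlgRat (prodPeriod (ellipticPeriod hI) (ellipticPeriod hI))) ^ 2) 4 = 2 := by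
  classical
  rw [cyclicMultiplicity_pow_eq_sum (by norm_num) (swapEnd_pow_eight hI) two_pos (by decide : 4 ∈ Nat.divisors 8)]
  have hfilter : (Nat.divisors 8).filter (fun d ↦ d / d.gcd 2 = 4) = {8} := by decide
  rw [hfilter, Finset.sum_singleton, cyclicMultiplicity_swapI_eight]
  decide

/-- The same multiplicity computed with the exponent `4` of `u²` (FILE 3's `h_4(i, i) = 2` for `(i, i) = u²`, up to the
exponent): `h_4(u²) = 2`. [cite: LangeRodriguez2022, §2.9 Prop. 2.9.3, p0046] -/
theorem cyclicMultiplicity_swapI_sq_four' :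
    cyclicMultiplicity (prodPeriod (ellipticPeriod hI) (ellipticPeriod hI)) 4
      ((⟨swapI.map (Int.cast : ℤ → ℚ), swapI_mem_endAlgRat hI⟩ :
        endAlgRat (prodPeriod (ellipticPeriod hI) (ellipticPeriod hI))) ^ 2) 4 = 2 := by
  have h4 : ((⟨swapI.map (Int.cast : ℤ → ℚ), swapI_mem_endAlgRat hI⟩ :
      endAlgRat (prodPeriod (ellipticPeriod hI) (ellipticPeriod hI))) ^ 2) ^ 4 = 1 := by
    rw [← pow_mul]
    exact swapEnd_pow_eight hI
  rw [← cyclicMultiplicity_mul_eq (t := 2) (by norm_num) h4 two_pos]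
  exact cyclicMultiplicity_swapI_sq_four hI

/-- Consistency with FILE 3: under `u² = (i, i)` the exponent-`4` multiplicity is FILE 3's `h_4(i, i) = 2`
(`cyclicMultiplicity_gaussSq_four`), computed there directly from `P^r_{(i,i)} = Φ_4²`. [cite: LangeRodriguez2022, §2.9 Prop. 2.9.3, p0046] -/
theorem cyclicMultiplicity_swapI_sq_eq_gaussSq :
    cyclicMultiplicity (prodPeriod (ellipticPeriod hI) (ellipticPeriod hI)) 4
      ((⟨swapI.map (Int.cast : ℤ → ℚ), swapI_mem_endAlgRat hI⟩ :
        endAlgRat (prodPeriod (ellipticPeriod hI) (ellipticPeriod hI))) ^ 2) 4 =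
      cyclicMultiplicity (prodPeriod (ellipticPeriod hI) (ellipticPeriod hI)) 4
        (⟨Matrix.fromBlocks gaussJ 0 0 gaussJ, gaussSq_mem_endAlgRat hI⟩ :
          endAlgRat (prodPeriod (ellipticPeriod hI) (ellipticPeriod hI))) 4 := by
  rw [swapEnd_sq]

end Swap

end ComplexTorus

end Literature.Geometry.Kaehler
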